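import Summits.HubbardSuperconductivity.HubbardSuperconductivity.Theorems.LiebTwinNoOnsiteODLROCouplingTransport
import Summits.HubbardSuperconductivity.HubbardSuperconductivity.Theorems.LiebTwinNoOnsiteODLROWeakCouplingOnsiteCeiling
import Summits.HubbardSuperconductivity.HubbardSuperconductivity.Theorems.LiebTwinTwinOnsiteCondensationCutExact
import Summits.HubbardSuperconductivity.HubbardSuperconductivity.Theorems.LiebTwinNoOnsiteODLROFreeEndpoint
import HarnessLib

/-!
# Crux `NoOnsiteODLRO` (stmt-HubbardSuperconductivity-0933) — helper: the ENERGY-FORM socket of the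
# coupling-monotonicity lever ("free gain dominance") and its free-gas anchor

`--supports stmt-HubbardSuperconductivity-0933` (routes `LiebTwin`, `EnslavedA1g`). Crux idea
`Ideas/coupling-monotone-onsite.md` (k2) reduces the crux to the antitonicity of the on-site pair structure
factor `S_L(U) = Re⟨ψ_U, P_sᴴP_s ψ_U⟩` in the coupling `U` (Hellmann–Feynman sign `dS/dU ≤ 0`) plus a
weak-coupling anchor. By the Maxwell relation for the two-parameter family
`H(U,c) = hubbardTorus 2 L 1 U − c·P_sᴴP_s` (`∂_U E = ⟨D⟩`, `∂_c E = −S`), the same sign in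
DEGENERACY-FREE, vector-free form is a comparison of reduced-BCS ENERGY GAINS
`Γ_L(U,c) := minEnergyOn (H_U) K − minEnergyOn (H_U − c·P_sᴴP_s) K` between the repulsive model and
the free gas. This file proves:

* `free_reducedGain_le` — **the free-gas side is closed**: for `a > 0`, `L ≥ ⌈800/√a⌉ + 3`, `c ≥ 0` with
  `2c·L² ≤ 16a/(10⁵·log²(4 + 8/√a))` (i.e. reduced coupling `g = c·L²` below half the pairing-cost rate)
  and every sector `(N, S^z = 0)`: `Γ_L(0,c) ≤ c·a·L⁴`. Proof: every unit sector vector either has on-site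
  pair density `< a` (then it gains `< c·a·L⁴`) or pays the level-uniform pairing cost
  `16a/(10⁵ log²)·L² ≥ 2c·L⁴ ≥ c·S` (`freeOnsitePairing_costs_energy_uniform_rate`, seat LiebTwin-0, with
  Yang's cap `S ≤ 2L⁴`), so `H₀ − c·P_sᴴP_s ≥ minEnergyOn H₀ − c·a·L⁴` on the sector.
* `onsiteDensity_le_of_gain_le` — **one coupling, one side**: if `Γ_L(U, g/L²) ≤ Γ_L(0, g/L²) + η·L²`
  at a sector ground state's coupling, then `S/L⁴ ≤ a + η/g` (on-site secant
  `smul_re_expect_le_minEnergyOn_sub`, seat LiebTwin-1 p157591, + the free bound).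
* `noOnsiteODLRO_of_freeGainDominance` — **the socket**: if for every `U > 0`, `δ ∈ (0,1/2)`, `g > 0`,
  `η > 0`, eventually along even `L` the reduced-BCS gain of `hubbardTorus 2 L 1 U` at reduced coupling
  `g/L²` in the crux's sector exceeds the FREE gas's gain by at most `η·L²` ("repulsion never makes the
  on-site BCS attraction pay more than it pays the free gas", the finite-difference/energy form of
  `dS/dU ≤ 0`), then `NoOnsiteODLRO`. No window, no eigenvector, no degeneracy bookkeeping: four sector
  energies per `L`.

The hypothesis of `noOnsiteODLRO_of_freeGainDominance` is OPEN (it is the crux's content in energy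
currency: by the secant it forces `S = o(L⁴)`; conversely nothing in the tree bounds the repulsive gain).
Sources: R. B. Griffiths, Phys. Rev. 152 (1966) 240, §II (coupling-constant inequalities); B. S. Shastry,
J. Phys. A 30 (1997) L635, eq. (1); J. Bardeen, L. N. Cooper, J. R. Schrieffer, Phys. Rev. 108 (1957) 1175,
§II; C. N. Yang, Rev. Mod. Phys. 34 (1962) 694, §4; H. Tasaki, Physics and Mathematics of Quantum
Many-Body Systems (2020) §2.2. Folklore finite-dimensional statements; no named facts, no definitions.

Tree search: `smul_re_expect_le_minEnergyOn_sub`, `minEnergyOn_le_rayleigh_of_mem`,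
`freeOnsitePairing_costs_energy_uniform_rate`, `re_expect_pairField_sWave_le_two_mul_pow_four`,
`exists_eq_two_mul_of_mem_szSector_zero`, `le_sq_of_mem_szSector_two_mul_zero`,
`mem_szSector_two_mul_zero_iff`, `LiebThm1.hamiltonian_isHermitian`.
-/

noncomputable section

set_option linter.dupNamespace false

namespace Summit.HubbardSuperconductivity.HubbardSuperconductivity.Theorems.NoOnsiteODLRO.GainDominance

open Matrix Finset Literature.Probability.LatticeModels Literature.MathematicalPhysics.QuantumLattice
open Summit.HubbardSuperconductivity.HubbardSuperconductivity.Theorems.NoOnsiteODLRO.OnsiteCeiling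
open Summit.HubbardSuperconductivity.HubbardSuperconductivity.Theorems.NoOnsiteODLRO.ReducedChannel
open Summit.HubbardSuperconductivity.HubbardSuperconductivity.Theorems.LiebTwinTwin
open scoped ComplexOrder ComplexConjugate

variable {L : ℕ} [NeZero L]

/-- The Rayleigh quotient of `H − c·PᴴP` splits: `Re⟨φ,(H − c·PᴴP)φ⟩ = Re⟨φ,Hφ⟩ − c·Re⟨φ,PᴴPφ⟩`
(real `c`). [folklore] -/
theorem re_rayleigh_sub_smul_conjTranspose_mul {ι : Type*} [Fintype ι] [DecidableEq ι]
    (H P : Matrix ι ι ℂ) (c : ℝ) (φ : ι → ℂ) :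
    (star φ ⬝ᵥ (H - (c : ℂ) • (Pᴴ * P)) *ᵥ φ).re =
      (star φ ⬝ᵥ H *ᵥ φ).re - c * (star φ ⬝ᵥ (Pᴴ * P) *ᵥ φ).re := by
  rw [sub_mulVec, dotProduct_sub, Complex.sub_re, smul_mulVec, dotProduct_smul, smul_eq_mul,
    Complex.re_ofReal_mul]

/-- **The free-gas side of gain dominance is a theorem.** For `a > 0`, `L ≥ ⌈800/√a⌉ + 3`, `c ≥ 0` with
`2c·L² ≤ 16a/(10⁵·log²(4 + 8/√a))`, and every sector `(N, S^z = 0)` of the torus of side `L`: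
`minEnergyOn H₀ K − minEnergyOn (H₀ − c·P_sᴴP_s) K ≤ c·a·L⁴` (`H₀ = hubbardTorus 2 L 1 0`): the reduced
on-site BCS attraction of reduced strength `g = c·L² ≤ rate(a)/2` gains at most density `a` per `L⁴/c`
on the FREE lattice gas — pairing costs kinetic energy (BCS 1957 §II, level-uniform form) against Yang's cap.
[folklore] -/
theorem free_reducedGain_le {a c : ℝ} (ha : 0 < a) (hc : 0 ≤ c)
    (hL : ⌈800 / Real.sqrt a⌉₊ + 3 ≤ L)
    (hcr : 2 * c * (L : ℝ) ^ 2 ≤ 16 * a / (100000 * Real.log (4 + 8 / Real.sqrt a) ^ 2)) (N : ℕ) :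
    (hubbardTorus 2 L 1 0).minEnergyOn (szSector (Λ := FermionTorus 2 L) N 0) -
        (hubbardTorus 2 L 1 0 - (c : ℂ) • ((pairField sWave L)ᴴ * pairField sWave L)).minEnergyOn
          (szSector (Λ := FermionTorus 2 L) N 0) ≤ c * a * (L : ℝ) ^ 4 := by
  set K : Submodule ℂ (Fock (Orb (FermionTorus 2 L))) := szSector (Λ := FermionTorus 2 L) N 0 with hK
  set H₀ : Matrix (Finset (Orb (FermionTorus 2 L))) (Finset (Orb (FermionTorus 2 L))) ℂ :=
    hubbardTorus 2 L 1 0 with hH₀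
  set PP : Matrix (Finset (Orb (FermionTorus 2 L))) (Finset (Orb (FermionTorus 2 L))) ℂ :=
    (pairField sWave L)ᴴ * pairField sWave L with hPP
  have hL0 : (0 : ℝ) < (L : ℝ) := by exact_mod_cast Nat.pos_of_ne_zero (NeZero.ne L)
  have hL4 : (0 : ℝ) ≤ c * a * (L : ℝ) ^ 4 := by positivity
  have hH : H₀.IsHermitian := LiebThm1.hamiltonian_isHermitian (fermionTorusGraph 2 L) 1 0
  by_cases hbot : K = ⊥
  · -- both sector energies are the junk value `sInf ∅ = 0`
    have hempty : ∀ M : Matrix (Finset (Orb (FermionTorus 2 L))) (Finset (Orb (FermionTorus 2 L))) ℂ,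
        {E : ℝ | ∃ ψ ∈ K, star ψ ⬝ᵥ ψ = 1 ∧ E = (star ψ ⬝ᵥ M *ᵥ ψ).re} = ∅ := by
      intro M
      ext E
      simp only [hbot, Submodule.mem_bot, Set.mem_setOf_eq, Set.mem_empty_iff_false, iff_false]
      rintro ⟨ψ, rfl, h1, -⟩
      simp at h1
    simp only [Matrix.minEnergyOn, hempty, Real.sInf_empty, sub_zero]
    exact hL4
  · -- lower bound on the perturbed sector energy, vector by vector
    obtain ⟨w, hwK, hw0⟩ := Submodule.exists_mem_ne_zero_of_ne_bot hbot
    obtain ⟨d, -, hd1⟩ := exists_smul_unit hw0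
    have hlow : H₀.minEnergyOn K - c * a * (L : ℝ) ^ 4 ≤ (H₀ - (c : ℂ) • PP).minEnergyOn K := by
      refine le_csInf ⟨_, d • w, K.smul_mem d hwK, hd1, rfl⟩ ?_
      rintro _ ⟨φ, hφ, hφ1, rfl⟩
      rw [re_rayleigh_sub_smul_conjTranspose_mul]
      have hmin := minEnergyOn_le_rayleigh_of_mem hH K hφ hφ1
      by_cases hS : a * (L : ℝ) ^ 4 ≤ (star φ ⬝ᵥ PP *ᵥ φ).re
      · -- macroscopic on-site pair density: the pairing cost beats the whole attraction
        have hcost := freeOnsitePairing_costs_energy_uniform_rate ha hL hφ hφ1 hS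
        have h0 : φ ≠ 0 := by rintro rfl; simp at hφ1
        obtain ⟨n, rfl⟩ := exists_eq_two_mul_of_mem_szSector_zero hφ h0
        have hn : n ≤ L ^ 2 := le_sq_of_mem_szSector_two_mul_zero hφ h0
        have hsec : IsInSector n n φ := (mem_szSector_two_mul_zero_iff n φ).1 hφ
        have hL3 : 3 ≤ L := by omega
        have hyang : (star φ ⬝ᵥ PP *ᵥ φ).re ≤ 2 * (L : ℝ) ^ 4 :=
          re_expect_pairField_sWave_le_two_mul_pow_four L hL3 hn hφ1 hsec
        have hcS : c * (star φ ⬝ᵥ PP *ᵥ φ).re ≤ 2 * c * (L : ℝ) ^ 2 * (L : ℝ) ^ 2 := by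
          nlinarith
        have hrate : 2 * c * (L : ℝ) ^ 2 * (L : ℝ) ^ 2 ≤
            16 * a / (100000 * Real.log (4 + 8 / Real.sqrt a) ^ 2) * (L : ℝ) ^ 2 :=
          mul_le_mul_of_nonneg_right hcr (by positivity)
        linarith
      · push Not at hS
        have hcS : c * (star φ ⬝ᵥ PP *ᵥ φ).re ≤ c * (a * (L : ℝ) ^ 4) :=
          mul_le_mul_of_nonneg_left hS.le hc
        linarith
    linarith

/-- **One coupling, one side.** Let `ψ` be a unit ground state of `hubbardTorus 2 L 1 U` in the sector
`(N, S^z = 0)`, `a, g > 0`, `L ≥ ⌈800/√a⌉ + 3` with `2g ≤ 16a/(10⁵·log²(4 + 8/√a))`, and suppose the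
reduced-BCS gain of the repulsive model at reduced coupling `g/L²` exceeds the free gas's by at most `η·L²`:
`Γ_L(U, g/L²) ≤ Γ_L(0, g/L²) + η·L²`. Then `Re⟨ψ, P_sᴴP_s ψ⟩ ≤ (a + η/g)·L⁴` (on-site secant: `(g/L²)·S ≤
Γ_L(U, g/L²)`; free side: `Γ_L(0, g/L²) ≤ g·a·L²`). Griffiths (1966) §II; Shastry (1997) eq. (1). [folklore] -/
theorem re_expect_le_of_gain_le {U a g η : ℝ} (ha : 0 < a) (hg : 0 < g)
    (hL : ⌈800 / Real.sqrt a⌉₊ + 3 ≤ L)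
    (hgr : 2 * g ≤ 16 * a / (100000 * Real.log (4 + 8 / Real.sqrt a) ^ 2)) {N : ℕ}
    {ψ : Fock (Orb (FermionTorus 2 L))} (hψ1 : star ψ ⬝ᵥ ψ = 1)
    (hψ : IsGroundStateInSector (hubbardTorus 2 L 1 U) N 0 ψ)
    (hgain : (hubbardTorus 2 L 1 U).minEnergyOn (szSector (Λ := FermionTorus 2 L) N 0) -
        (hubbardTorus 2 L 1 U - ((g / (L : ℝ) ^ 2 : ℝ) : ℂ) •
            ((pairField sWave L)ᴴ * pairField sWave L)).minEnergyOn (szSector (Λ := FermionTorus 2 L) N 0) ≤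
      (hubbardTorus 2 L 1 0).minEnergyOn (szSector (Λ := FermionTorus 2 L) N 0) -
        (hubbardTorus 2 L 1 0 - ((g / (L : ℝ) ^ 2 : ℝ) : ℂ) •
            ((pairField sWave L)ᴴ * pairField sWave L)).minEnergyOn (szSector (Λ := FermionTorus 2 L) N 0) +
          η * (L : ℝ) ^ 2) :
    (star ψ ⬝ᵥ ((pairField sWave L)ᴴ * pairField sWave L) *ᵥ ψ).re ≤ (a + η / g) * (L : ℝ) ^ 4 := by
  obtain ⟨hmem, -, heig⟩ := hψ
  have hH : (hubbardTorus 2 L 1 U).IsHermitian := LiebThm1.hamiltonian_isHermitian (fermionTorusGraph 2 L) 1 U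
  have hground : (star ψ ⬝ᵥ (hubbardTorus 2 L 1 U) *ᵥ ψ).re =
      (hubbardTorus 2 L 1 U).minEnergyOn (szSector (Λ := FermionTorus 2 L) N 0) := by
    rw [heig, dotProduct_smul, hψ1, smul_eq_mul, mul_one, Complex.ofReal_re]
  have hL0 : (0 : ℝ) < (L : ℝ) := by exact_mod_cast Nat.pos_of_ne_zero (NeZero.ne L)
  have hL2 : (0 : ℝ) < (L : ℝ) ^ 2 := by positivity
  set c : ℝ := g / (L : ℝ) ^ 2 with hc
  have hc0 : 0 ≤ c := by positivity
  have hcL : c * (L : ℝ) ^ 2 = g := by rw [hc]; field_simp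
  have hcr : 2 * c * (L : ℝ) ^ 2 ≤ 16 * a / (100000 * Real.log (4 + 8 / Real.sqrt a) ^ 2) := by
    rw [mul_assoc, hcL]; exact hgr
  have hsec := smul_re_expect_le_minEnergyOn_sub hH (pairField sWave L) c (szSector N 0) hmem hψ1 hground
  have hfree := free_reducedGain_le ha hc0 hL hcr N
  -- (g/L²)·S ≤ Γ(U) ≤ Γ(0) + ηL² ≤ c a L⁴ + η L²
  have hchain : c * (star ψ ⬝ᵥ ((pairField sWave L)ᴴ * pairField sWave L) *ᵥ ψ).re ≤
      c * a * (L : ℝ) ^ 4 + η * (L : ℝ) ^ 2 := by linarith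
  -- divide by c = g/L² > 0
  have hc_pos : 0 < c := by positivity
  have hkey : (star ψ ⬝ᵥ ((pairField sWave L)ᴴ * pairField sWave L) *ᵥ ψ).re ≤
      a * (L : ℝ) ^ 4 + η * (L : ℝ) ^ 2 / c := by
    rw [← sub_nonneg] at hchain ⊢
    have : a * (L : ℝ) ^ 4 + η * (L : ℝ) ^ 2 / c -
        (star ψ ⬝ᵥ ((pairField sWave L)ᴴ * pairField sWave L) *ᵥ ψ).re =
        (c * a * (L : ℝ) ^ 4 + η * (L : ℝ) ^ 2 -
          c * (star ψ ⬝ᵥ ((pairField sWave L)ᴴ * pairField sWave L) *ᵥ ψ).re) / c := by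
      field_simp
    rw [this]
    exact div_nonneg hchain hc_pos.le
  have hdiv : η * (L : ℝ) ^ 2 / c = η / g * (L : ℝ) ^ 4 := by
    rw [hc]
    field_simp
  rw [hdiv] at hkey
  linarith

/-- **ENERGY-FORM SOCKET OF THE COUPLING-MONOTONICITY LEVER ("free gain dominance") ⇒ the crux.**
Hypothesis (OPEN; the finite-difference, degeneracy-free form of `dS/dU ≤ 0` integrated from `0` to `U`,
via the Maxwell relation `∂_U S = −∂_c ⟨D⟩` for `H(U,c) = hubbardTorus 2 L 1 U − c·P_sᴴP_s`): for every
`U > 0`, `δ ∈ (0,1/2)`, `g > 0`, `η > 0`, eventually along even `L`, in the sector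
`(2⌊(1−δ)L²/2⌋, S^z = 0)`,
`Γ_L(U, g/L²) ≤ Γ_L(0, g/L²) + η·L²`, `Γ_L(U,c) := minEnergyOn H_U − minEnergyOn (H_U − c·P_sᴴP_s)` —
the reduced on-site BCS attraction never gains macroscopically MORE energy on the repulsive Hubbard torus
than on the free lattice gas. Conclusion: `NoOnsiteODLRO` (route LiebTwin / EnslavedA1g crux, verbatim).
Proof: given `ε`, take `a = ε/2`, `g = rate(a)/2`, `η = g·ε/2`; `re_expect_le_of_gain_le`. The free side
is a theorem (`free_reducedGain_le`), so the socket's only open content is the comparison of the two gains.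
Griffiths, Phys. Rev. 152 (1966) 240, §II; Shastry, J. Phys. A 30 (1997) L635; BCS (1957) §II. [folklore] -/
theorem noOnsiteODLRO_of_freeGainDominance
    (hFGD : ∀ (U δ : ℝ), 0 < U → δ ∈ Set.Ioo (0 : ℝ) (1 / 2) → ∀ g : ℝ, 0 < g → ∀ η : ℝ, 0 < η →
      ∃ L₀ : ℕ, ∀ (L : ℕ) [NeZero L], Even L → L₀ ≤ L →
        (hubbardTorus 2 L 1 U).minEnergyOn
              (szSector (Λ := FermionTorus 2 L) (2 * ⌊(1 - δ) * (L : ℝ) ^ 2 / 2⌋₊) 0) -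
            (hubbardTorus 2 L 1 U - ((g / (L : ℝ) ^ 2 : ℝ) : ℂ) •
                ((pairField sWave L)ᴴ * pairField sWave L)).minEnergyOn
              (szSector (Λ := FermionTorus 2 L) (2 * ⌊(1 - δ) * (L : ℝ) ^ 2 / 2⌋₊) 0) ≤
          (hubbardTorus 2 L 1 0).minEnergyOn
              (szSector (Λ := FermionTorus 2 L) (2 * ⌊(1 - δ) * (L : ℝ) ^ 2 / 2⌋₊) 0) -
            (hubbardTorus 2 L 1 0 - ((g / (L : ℝ) ^ 2 : ℝ) : ℂ) •
                ((pairField sWave L)ᴴ * pairField sWave L)).minEnergyOn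
              (szSector (Λ := FermionTorus 2 L) (2 * ⌊(1 - δ) * (L : ℝ) ^ 2 / 2⌋₊) 0) +
            η * (L : ℝ) ^ 2) :
    Theses.LiebTwin.NoOnsiteODLRO := by
  intro U δ hU hδ N ψ hyp ε hε
  -- constants: pair-density budget a = ε/2, reduced coupling g = rate(a)/2, slack η = g ε / 2
  set a : ℝ := ε / 2 with ha_def
  have ha : 0 < a := by positivity
  set r : ℝ := 16 * a / (100000 * Real.log (4 + 8 / Real.sqrt a) ^ 2) with hr_def
  have hlog : 0 < Real.log (4 + 8 / Real.sqrt a) := by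
    apply Real.log_pos
    have : 0 < 8 / Real.sqrt a := div_pos (by norm_num) (Real.sqrt_pos.2 ha)
    linarith
  have hr : 0 < r := by positivity
  set g : ℝ := r / 2 with hg_def
  have hg : 0 < g := by positivity
  have hgr : 2 * g ≤ r := by rw [hg_def]; linarith
  set η : ℝ := g * ε / 2 with hη_def
  have hη : 0 < η := by positivity
  obtain ⟨L₁, hL₁⟩ := hFGD U δ hU hδ g hg η hη
  refine ⟨max L₁ (⌈800 / Real.sqrt a⌉₊ + 3), fun L _ hLe hL => ?_⟩
  obtain ⟨hN, h1, hgs⟩ := hyp L hLe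
  have hLa : ⌈800 / Real.sqrt a⌉₊ + 3 ≤ L := le_of_max_le_right hL
  have hgain := hL₁ L hLe (le_of_max_le_left hL)
  rw [← hN] at hgain
  have hS := re_expect_le_of_gain_le ha hg hLa hgr h1 hgs hgain
  have hL0 : (0 : ℝ) < (L : ℝ) := by exact_mod_cast Nat.pos_of_ne_zero (NeZero.ne L)
  have hL4 : (0 : ℝ) < (L : ℝ) ^ 4 := by positivity
  have hcoef : a + η / g = ε := by
    rw [hη_def, ha_def]
    field_simp
    ring
  rw [hcoef] at hS
  change (star (ψ L) ⬝ᵥ ((pairField sWave L)ᴴ * pairField sWave L) *ᵥ ψ L).re / (L : ℝ) ^ 4 ≤ ε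
  rw [div_le_iff₀ hL4]
  exact hS

/-- REGISTERED STUB `stub_freeReducedGain` of crux stmt-HubbardSuperconductivity-0933 (verbatim signature; a
BY-PRODUCT — the free-gas anchor of the energy-form monotonicity socket — not a piece of a line's composition
`NoOnsiteODLRO_of`): for every side `L`, `a > 0`, `c ≥ 0` with `L ≥ ⌈800/√a⌉ + 3` and
`2c·L² ≤ 16a/(10⁵·log²(4 + 8/√a))`, and every sector `(N, S^z = 0)`, the reduced on-site BCS attraction
`c·P_sᴴP_s` lowers the FREE sector energy by at most `c·a·L⁴` (`= free_reducedGain_le`). BCS (1957) §II;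
Yang (1962) §4. [folklore] -/
theorem stub_freeReducedGain :
    ∀ (L : ℕ) [NeZero L] (a c : ℝ), 0 < a → 0 ≤ c → ⌈800 / Real.sqrt a⌉₊ + 3 ≤ L →
      2 * c * (L : ℝ) ^ 2 ≤ 16 * a / (100000 * Real.log (4 + 8 / Real.sqrt a) ^ 2) →
        ∀ (N : ℕ), (hubbardTorus 2 L 1 0).minEnergyOn (szSector (Λ := FermionTorus 2 L) N 0) -
            (hubbardTorus 2 L 1 0 - (c : ℂ) • ((pairField sWave L)ᴴ * pairField sWave L)).minEnergyOn
              (szSector (Λ := FermionTorus 2 L) N 0) ≤ c * a * (L : ℝ) ^ 4 :=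
  fun _ _ _ _ ha hc hL hcr N => free_reducedGain_le ha hc hL hcr N

/-! ### The vector form with zero slack: free dominance -/

/-- **FREE DOMINANCE ⇒ the crux, with the optimal rate.** Hypothesis (OPEN; the `C = 0`, `U₁ = 0`
instance of the card's finite-volume `OnsiteCouplingMonotone`, i.e. `dS/dU ≤ 0` integrated from the free
endpoint; it held in every exact-diagonalisation test of seat LiebTwin-1's session 4): for every `U > 0`,
eventually in the side `L`, every unit `(N, S^z = 0)`-sector ground state `ψ` of `hubbardTorus 2 L 1 U` has
on-site pair structure factor at most that of SOME unit ground state `φ` of the FREE torus in the same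
sector — repulsion never raises on-site pairing above its free value. Conclusion: `NoOnsiteODLRO`, indeed
with the sharp `L²` law `S_L ≤ N_L + 8L² ≤ 10L²` of the free endpoint (`re_expect_pairField_sWave_le_free`,
p156125; the rate `L²` is attained at `U = 0`, `Negative/FreeEndpointTightness`). No anchor, no window,
no energy. Yang, Rev. Mod. Phys. 34 (1962) 694, §3; Griffiths, Phys. Rev. 152 (1966) 240, §II. [folklore] -/
theorem noOnsiteODLRO_of_freeDominance
    (hFD : ∀ U : ℝ, 0 < U → ∃ L₀ : ℕ, ∀ (L : ℕ) [NeZero L], L₀ ≤ L →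
      ∀ (N : ℕ) (ψ : Fock (Orb (FermionTorus 2 L))), star ψ ⬝ᵥ ψ = 1 →
        IsGroundStateInSector (hubbardTorus 2 L 1 U) N 0 ψ →
          ∃ φ : Fock (Orb (FermionTorus 2 L)), star φ ⬝ᵥ φ = 1 ∧
            IsGroundStateInSector (hubbardTorus 2 L 1 0) N 0 φ ∧
              (star ψ ⬝ᵥ ((pairField sWave L)ᴴ * pairField sWave L) *ᵥ ψ).re ≤
                (star φ ⬝ᵥ ((pairField sWave L)ᴴ * pairField sWave L) *ᵥ φ).re) :
    Theses.LiebTwin.NoOnsiteODLRO := by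
  intro U δ hU hδ N ψ hyp ε hε
  obtain ⟨L₁, hL₁⟩ := hFD U hU
  refine ⟨max L₁ (⌈10 / ε⌉₊ + 3), fun L _ hLe hL => ?_⟩
  obtain ⟨hN, h1, hgs⟩ := hyp L hLe
  have hL₀ : ⌈10 / ε⌉₊ + 3 ≤ L := le_of_max_le_right hL
  have hL3 : 3 ≤ L := le_of_add_le_right hL₀
  have hLpos : (0 : ℝ) < L := by exact_mod_cast (show 0 < L by omega)
  obtain ⟨φ, hφ1, hφgs, hle⟩ := hL₁ L (le_of_max_le_left hL) (N L) (ψ L) h1 hgs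
  have hfree := FreeEndpoint.re_expect_pairField_sWave_le_free hL3 hφgs hφ1
  -- `N_L = 2⌊(1-δ)L²/2⌋ ≤ 2L²`
  have hNle : (N L : ℝ) ≤ 2 * (L : ℝ) ^ 2 := by
    have h := Negative.floor_filling_le_sq hδ.1.le L
    have h' : N L ≤ 2 * L ^ 2 := by rw [hN]; omega
    exact_mod_cast h'
  have hS : (star (ψ L) ⬝ᵥ ((pairField sWave L)ᴴ * pairField sWave L) *ᵥ ψ L).re ≤ 10 * (L : ℝ) ^ 2 := by
    change _ ≤ (expect ((pairField sWave L)ᴴ * pairField sWave L) φ).re at hle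
    linarith
  -- `10 L² ≤ ε L⁴` once `L ≥ 10/ε`
  have hL4 : (0 : ℝ) < (L : ℝ) ^ 4 := by positivity
  have hLε : 10 / ε ≤ (L : ℝ) := by
    have h1' : (10 / ε : ℝ) ≤ ⌈10 / ε⌉₊ := Nat.le_ceil _
    have h2' : ((⌈10 / ε⌉₊ : ℕ) : ℝ) ≤ L := by exact_mod_cast (le_of_add_le_left hL₀ : ⌈10 / ε⌉₊ ≤ L)
    linarith
  have h10 : 10 ≤ ε * (L : ℝ) := by
    rw [div_le_iff₀ hε] at hLε; linarith
  change (star (ψ L) ⬝ᵥ ((pairField sWave L)ᴴ * pairField sWave L) *ᵥ ψ L).re / (L : ℝ) ^ 4 ≤ ε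
  rw [div_le_iff₀ hL4]
  have hL1 : (1 : ℝ) ≤ (L : ℝ) := by exact_mod_cast (show 1 ≤ L by omega)
  have hL2 : (0 : ℝ) ≤ (L : ℝ) ^ 2 := by positivity
  have hC : (L : ℝ) ^ 2 ≤ (L : ℝ) ^ 3 := by
    calc (L : ℝ) ^ 2 = (L : ℝ) ^ 2 * 1 := by ring
      _ ≤ (L : ℝ) ^ 2 * L := mul_le_mul_of_nonneg_left hL1 hL2
      _ = (L : ℝ) ^ 3 := by ring
  have hB : 10 * (L : ℝ) ^ 3 ≤ ε * (L : ℝ) * (L : ℝ) ^ 3 :=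
    mul_le_mul_of_nonneg_right h10 (by positivity)
  have h4 : ε * (L : ℝ) ^ 4 = ε * (L : ℝ) * (L : ℝ) ^ 3 := by ring
  rw [h4]
  linarith

/-- REGISTERED STUB `stub_freeDominanceTransfer` of crux stmt-HubbardSuperconductivity-0933 (verbatim
signature; a BY-PRODUCT — the transfer "free dominance ⇒ crux" — whose hypothesis is OPEN; not a piece of a
line's composition `NoOnsiteODLRO_of`): `= noOnsiteODLRO_of_freeDominance`. Yang (1962) §3. [folklore] -/
theorem stub_freeDominanceTransfer :
    (∀ U : ℝ, 0 < U → ∃ L₀ : ℕ, ∀ (L : ℕ) [NeZero L], L₀ ≤ L →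
      ∀ (N : ℕ) (ψ : Fock (Orb (FermionTorus 2 L))), star ψ ⬝ᵥ ψ = 1 →
        IsGroundStateInSector (hubbardTorus 2 L 1 U) N 0 ψ →
          ∃ φ : Fock (Orb (FermionTorus 2 L)), star φ ⬝ᵥ φ = 1 ∧
            IsGroundStateInSector (hubbardTorus 2 L 1 0) N 0 φ ∧
              (star ψ ⬝ᵥ ((pairField sWave L)ᴴ * pairField sWave L) *ᵥ ψ).re ≤
                (star φ ⬝ᵥ ((pairField sWave L)ᴴ * pairField sWave L) *ᵥ φ).re) →
      Summit.HubbardSuperconductivity.HubbardSuperconductivity.Theses.LiebTwin.NoOnsiteODLRO :=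
  noOnsiteODLRO_of_freeDominance

end Summit.HubbardSuperconductivity.HubbardSuperconductivity.Theorems.NoOnsiteODLRO.GainDominance
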